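/-
Copyright: statement-level skeleton of a published paper (lit-balaban cell, Phase-2 proof seat p39 gen 15). No proof claims
beyond what the kernel checks below.
-/
import Literature.MathematicalPhysics.QuantumFieldTheory.Balaban1983to89.B3FreeWickVertexCalculus
import Literature.MathematicalPhysics.QuantumFieldTheory.Balaban1983to89.B3WTPeriodicMeasure

/-!
# B3 — T. Bałaban, *(Higgs)₂,₃ quantum fields in a finite volume. III. Renormalization*, CMP **88** (1983) 411–445
[Balaban1983Higgs3], (2.28) p. 431 [PDF 21]: **(2.28) AT FREE BOUNDARY CONDITIONS — the identity for
`F(φ) = −λ_kΣ_{x∈Δ}η^d:|φ(x)|⁴:` DRAWN ON THE INFINITE LATTICE `ηℤ^d`, for the Gaussian field `dμ_C` of EVERY positive semidefinite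
colour-diagonal kernel `δ_{ab}C(x − y)`**: the Gaussian left member
`∫dμ_C F·[(−e⟨∂^ηφ,Bqφ⟩)(:⟨∂^ηφ,∂^ηλqφ⟩:) − e⟨φ,B·∂^ηλq²φ⟩ − ηe⟨∂^ηφ,B∂^ηλq²φ⟩]` equals the sum of its two-loop pictures
`A`–loop–`:φ⁴:`–loop–`∂^ηλ`, and every picture is `0` — at free boundary conditions (`C = C^η_{M²}`, `dμ_{C^η_{M²}}` of
`B3WTFreeMeasure`), with periodic boundary conditions (`C = C_L`: the torus Gaussian measures read on `ℤ^d`, `B3WTPeriodicMeasure`),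
and for every other such kernel alike (file 2/2; file 1/2 = `B3FreeWickVertexCalculus`, the contraction rules of `:|φ(x)|⁴:_C`)

statement-level skeleton of published theorems with citation tags; proofs where landed; nothing here is a claim about
the Yang–Mills mass gap

PDF held: `paper:balaban1983-higgs-2-3-quantum-fields-finite-volume` (journal page = PDF page + 410); p. 431 [PDF 21] re-read for this
file (`lit read … --pages 20-21`, text layer `p0021.txt` L14–22; p. 434 mechanism as quoted in `B3WT228Graphs`).

CITATION HEADER (lean-in-tree rule).  Part of the lit-balaban TYPED SKELETON (HOME `run/shared/lean/pub/lit-balaban/`), PHASE 2,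
proof seat p39 (generation 15).  Row **B3.Eq2.26-2.28** of `HOME/lit-balaban-r15/ROWS-B3.md` (fold owner r15; head `typed p247909`;
the owner's head proposal of 2026-08-22T17:43Z lists as residual prose (b) *"They hold for free boundary conditions also by taking a
limit of the identities with periodic boundary conditions"* — proved for (2.25)/(2.26) by this seat's gen 11/12
(`B3WT226FreeGaussian`, `B3WTPeriodicMeasure`), NOT for (2.28); this file does (2.28)).  THE TORUS VERSION it transcribes: gen 14's
`B3WT228Graphs` ((2.28) drawn on the model torus: `integral_wick4_JJ_eq_zero`, `eq228_wick`, `eq228`) — same architecture, with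
the ℤ^d pairings `curJ`/`pairD`/`locQ`/`derQ`/`normOrd` of `B3WT226FreeGaussian`, the printed integrand `integrand226` and the
measures `freeMeasure`/`periodicMeasure`/`torusMeasure`/`pullT` of `B3WTPeriodicMeasure`, the vertex `wick4K` and its contraction rules
of file 1/2, and the trace identities `B3WTWick.sum_inner_mul_inner_qq/_q_q`, `B3WT226Pairings.inner_q_self` BY NAME.

THE PRINTED TEXT (verbatim, p. 431 L14–22 [PDF 21]).  *"where now the propagators are C^η_{M²}. Doing next the same operations as
above but in the presence of F(φ) = −λ_k Σ_{x∈Δ} η^d:|φ(x)|⁴:, we get the identities represented graphically in the following way: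
[(2.28): ONE picture — the vector leg A, a loop of two scalar lines, the four-leg vertex, a second loop of two scalar lines, the leg
∂^ηλ] = 0. Taking other functions F, or differentiating (2.24) to higher order in A, we can get all necessary Ward-Takahashi
identities. They hold for free boundary conditions also by taking a limit of the identities with periodic boundary conditions."*

WHAT IS PROVED (theorems only; `d`, `N` arbitrary; `C : ℤ^d → ℝ` with `δ_{ab}C(x − y)` positive semidefinite — hypothesis `hK`;
`dμ_C = kernelMeasure d N C`; external legs `B` (print: `A`) and `∂^ηλ` on the bonds based in a window `S`, the `:φ⁴:` vertices in a
finite `Δ` with coefficients `α` (print: `α = −λ_k`); charge `e = C.e`, antisymmetric `q = C.q` of the model's `HiggsLattice.ChargeData`).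
* §1 **`integral_wick4K_JJ_eq`** — THE TWO-LOOP PICTURE EVALUATED: `∫:|φ(x)|⁴:_C⟪φ(y₁),qφ(y₂)⟫⟪φ(y₃),qφ(y₄)⟫dμ_C =
  8·Π_jC(x − y_j)·Σ_{i,k}(⟪e_i,qe_i⟫⟪e_k,qe_k⟫ + ⟪e_i,e_k⟫⟪qe_i,qe_k⟫ + ⟪e_i,qe_k⟫⟪qe_i,e_k⟫)` (file 1/2's `integral_wick4K_mul_four`:
  two legs into each current vertex), and **`integral_wick4K_JJ_eq_zero`**: it VANISHES — the colour trace is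
  `(tr q)² − tr q² + tr q² = 0`, the p. 434 mechanism *"a loop of scalar field lines with an odd number of vector field legs"*
  (`JJ_expand`, `integrable_wick4K_mul_JJ`).
* §2 the assembly, as in `B3WT228Graphs`: `integral_wick4K_curJ_pairD_expand`/`_curJ_pairD` (`Σ_{b,b′}` of the pictures, `= 0`),
  `integral_wick4K_locQ`/`_derQ` (no seagull picture, file 1/2's `integral_wick4K_biq_eq_zero`), `eq228_integrand_splitK`,
  **`eq228_wickK`** (the Gaussian left member `∫dμ_C (Σ_{x∈Δ}η^dα(x):|φ(x)|⁴:)·integrand226 = Σ_{x,b,b′}` two-loop pictures),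
  `eq228_pictures_eq_zeroK`, **`eq228_kernel`** (`= 0` for EVERY positive semidefinite colour-diagonal kernel), the instances
  **`eq228_free`** (`C = C^η_{M²}`, `η > 0`, `M² > 0`: (2.28) AT FREE BOUNDARY CONDITIONS), **`eq228_periodic`** (`C = C_L`, every period
  `L ≥ 1`), `eq228_free_both` (left member = Σ pictures ∧ Σ pictures = 0), `eq228_kernel_poly` (the same for the un-ordered local even
  polynomial with the Wick constants `β = −2(N+2)C(0)α`, `γ = N(N+2)C(0)²α`).
* §3 `eq228_free_explicit` (the display spelled out), `measurable_eq228_integrand`, **`eq228_periodic_eq_integral_torus`** (the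
  periodic left member IS a torus Gaussian integral against `dμ_{C_T}`, `map_pullT_torusMeasure`) and **`eq228_torus`** ((2.28) *"with
  periodic boundary conditions"* on the cubic torus `(ℤ/Lℤ)^d`, every `L ≥ 1`).
HONEST SCOPE: (i) for (2.28) the print's route *"by taking a limit of the identities with periodic boundary conditions"* is
available (`eq228_torus`/`eq228_periodic` for all `L`, the marginals converge by `B3WTPeriodicMeasure.tendsto_marginal_periodic`) but
NOT NEEDED: the identity holds for the Gaussian field of every kernel, because its only picture vanishes by the colour trace at the
`:φ⁴:` vertex whatever the propagator — unlike (2.26), whose pictures vanish only for the propagator of `−Δ^η + M²` (gen 11/12);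
(ii) the LEFT member here is the Gaussian integral of the printed integrand against `dμ_C` (as in `B3WT226FreeGaussian`); its
DERIVATION as the `A`-derivative of (2.24) with `F` (gauge covariance of `A`-dependent measures) stays on the model torus
(`B3WT228Left.eq228_deriv`); (iii) the torus of `eq228_torus` is the cubic `(ℤ/Lℤ)^d` of `B3WT226PeriodicKernel`, not the model's
anisotropic `T^{(j)}` (there: `B3WT228Graphs.eq228`); (iv) the identities for `F = :|φ(x)|²:` ("other functions F", drawn on the
model torus in `B3WT228Phi2Graphs`) are NOT transcribed: their pictures do not vanish one by one, and their sum vanishes by a kernel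
identity for `C^η_{M²}` (the (2.26) bracket opened at `x`) which is not in the tree for `ηℤ^d`; "higher order in A" not done.
Mathlib + the cited tree files only; theorems, no definition, no named fact, no `sorry`; standard axioms.  Unit `lit-balaban-p39-g15`
(Phase-2 proof seat p39, gen 15), HOME `run/shared/lean/pub/lit-balaban/`, 2026-08-22.

References: [Balaban1983Higgs3] T. Bałaban, CMP 88 (1983) 411–445, (2.26)–(2.28) p. 431, p. 434; [GlimmJaffeQP1987] J. Glimm,
A. Jaffe, *Quantum Physics*, 2nd ed. (1987), Cor. 8.3.2 (8.3.7)–(8.3.9); [Janson1997] S. Janson, *Gaussian Hilbert Spaces*, Thm 1.28.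
-/

noncomputable section

open scoped BigOperators InnerProductSpace
open MeasureTheory ProbabilityTheory Finset

namespace Literature.MathematicalPhysics.QuantumFieldTheory.Balaban1983to89.B3WT228FreeGaussian

open B3Sect3VectorSelfEnergy B3CxiPropagator B3WT226FreeLattice B3WTFreeMeasure B3WTFreeWick B3GaussianContractions
open B3WT226FreeGaussian B3WT226PeriodicLimit B3WTPeriodicMeasure B3FreeWickVertexCalculus
open B3WTCovariance (trE)
open B3WT226Pairings (inner_q_self inner_q_left)
open B3WTWick (inner_q_expand sum_inner_mul_inner_qq sum_inner_mul_inner_q_q)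
open Literature.MathematicalPhysics.QuantumFieldTheory
open Literature.Probability.Distributions

variable {d N : ℕ} (C : HiggsLattice.ChargeData N) (η : ℝ) {Cv : ZSite d → ℝ} {M2 : ℝ}

/-! ## §1 The two-loop picture of (2.28) on `ηℤ^d` -/

section Pictures

/-- the product of two current vertices in the coordinate basis: `⟪φ(y₁),qφ(y₂)⟫⟪φ(y₃),qφ(y₄)⟫ =
Σ_{i,k}⟪φ(y₁),e_i⟫⟪φ(y₂),qe_i⟫⟪φ(y₃),e_k⟫⟪φ(y₄),qe_k⟫` (`q* = −q`). [cite: Balaban1983Higgs3, (2.26) p.431] -/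
theorem JJ_expand (ω : Cfg d N) (y₁ y₂ y₃ y₄ : ZSite d) :
    ⟪fld ω y₁, C.q (fld ω y₂)⟫_ℝ * ⟪fld ω y₃, C.q (fld ω y₄)⟫_ℝ = ∑ i : Fin N, ∑ k : Fin N,
      ⟪fld ω y₁, EuclideanSpace.basisFun (Fin N) ℝ i⟫_ℝ * ⟪fld ω y₂, C.q (EuclideanSpace.basisFun (Fin N) ℝ i)⟫_ℝ *
        ⟪fld ω y₃, EuclideanSpace.basisFun (Fin N) ℝ k⟫_ℝ * ⟪fld ω y₄, C.q (EuclideanSpace.basisFun (Fin N) ℝ k)⟫_ℝ := by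
  rw [inner_q_expand C (fld ω y₁), inner_q_expand C (fld ω y₃), neg_mul_neg, Finset.sum_mul_sum]
  exact Finset.sum_congr rfl fun i _ => Finset.sum_congr rfl fun k _ => by ring

/-- `:|φ(x)|⁴:` times two current vertices is integrable. [cite: Janson1997, Ch. 1 §3, sentence before Thm 1.28] -/
theorem integrable_wick4K_mul_JJ (hK : IsPosSemidefKernel (scalarKernel d N Cv)) (x y₁ y₂ y₃ y₄ : ZSite d) :
    Integrable (fun ω => wick4K Cv ω x * (⟪fld ω y₁, C.q (fld ω y₂)⟫_ℝ * ⟪fld ω y₃, C.q (fld ω y₄)⟫_ℝ))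
      (kernelMeasure d N Cv) := by
  set e := EuclideanSpace.basisFun (Fin N) ℝ with he
  have e1 : (fun ω => wick4K Cv ω x * (⟪fld ω y₁, C.q (fld ω y₂)⟫_ℝ * ⟪fld ω y₃, C.q (fld ω y₄)⟫_ℝ)) =
      fun ω => ∑ i : Fin N, ∑ k : Fin N, wick4K Cv ω x *
        (⟪fld ω y₁, e i⟫_ℝ * ⟪fld ω y₂, C.q (e i)⟫_ℝ * ⟪fld ω y₃, e k⟫_ℝ * ⟪fld ω y₄, C.q (e k)⟫_ℝ) := by
    funext ω
    rw [JJ_expand, Finset.mul_sum]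
    exact Finset.sum_congr rfl fun i _ => Finset.mul_sum _ _ _
  rw [e1]
  refine integrable_finsetSum _ fun i _ => integrable_finsetSum _ fun k _ => ?_
  have h := integrable_wick4K_mul_four hK x ![y₁, y₂, y₃, y₄] ![e i, C.q (e i), e k, C.q (e k)]
  simp only [Matrix.cons_val_zero, Matrix.cons_val_one, Matrix.cons_val_two, Matrix.cons_val_three, Matrix.head_cons,
    Matrix.tail_cons] at h
  exact h

/-- **THE TWO-LOOP PICTURE OF (2.28) EVALUATED**: `∫ :|φ(x)|⁴:_C ⟪φ(y₁),qφ(y₂)⟫⟪φ(y₃),qφ(y₄)⟫ dμ_C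
= 8·C(x−y₁)C(x−y₂)C(x−y₃)C(x−y₄)·Σ_{i,k}(⟪e_i,qe_i⟫⟪e_k,qe_k⟫ + ⟪e_i,e_k⟫⟪qe_i,qe_k⟫ + ⟪e_i,qe_k⟫⟪qe_i,e_k⟫)` — the four legs of
`:|φ(x)|⁴:` contracted two into each current vertex (four propagators out of `x`), times the colour trace of the two loops.
[cite: Balaban1983Higgs3, (2.28) p.431] -/
theorem integral_wick4K_JJ_eq (hK : IsPosSemidefKernel (scalarKernel d N Cv)) (x y₁ y₂ y₃ y₄ : ZSite d) :
    ∫ ω, wick4K Cv ω x * (⟪fld ω y₁, C.q (fld ω y₂)⟫_ℝ * ⟪fld ω y₃, C.q (fld ω y₄)⟫_ℝ) ∂kernelMeasure d N Cv =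
      8 * (Cv (x - y₁) * Cv (x - y₂) * Cv (x - y₃) * Cv (x - y₄)) * ∑ i : Fin N, ∑ k : Fin N,
        (⟪EuclideanSpace.basisFun (Fin N) ℝ i, C.q (EuclideanSpace.basisFun (Fin N) ℝ i)⟫_ℝ *
            ⟪EuclideanSpace.basisFun (Fin N) ℝ k, C.q (EuclideanSpace.basisFun (Fin N) ℝ k)⟫_ℝ
          + ⟪EuclideanSpace.basisFun (Fin N) ℝ i, EuclideanSpace.basisFun (Fin N) ℝ k⟫_ℝ *
            ⟪C.q (EuclideanSpace.basisFun (Fin N) ℝ i), C.q (EuclideanSpace.basisFun (Fin N) ℝ k)⟫_ℝ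
          + ⟪EuclideanSpace.basisFun (Fin N) ℝ i, C.q (EuclideanSpace.basisFun (Fin N) ℝ k)⟫_ℝ *
            ⟪C.q (EuclideanSpace.basisFun (Fin N) ℝ i), EuclideanSpace.basisFun (Fin N) ℝ k⟫_ℝ) := by
  set e := EuclideanSpace.basisFun (Fin N) ℝ with he
  have hI : ∀ i k : Fin N, Integrable (fun ω => wick4K Cv ω x *
      (⟪fld ω y₁, e i⟫_ℝ * ⟪fld ω y₂, C.q (e i)⟫_ℝ * ⟪fld ω y₃, e k⟫_ℝ * ⟪fld ω y₄, C.q (e k)⟫_ℝ)) (kernelMeasure d N Cv) := by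
    intro i k
    have h := integrable_wick4K_mul_four hK x ![y₁, y₂, y₃, y₄] ![e i, C.q (e i), e k, C.q (e k)]
    simp only [Matrix.cons_val_zero, Matrix.cons_val_one, Matrix.cons_val_two, Matrix.cons_val_three, Matrix.head_cons,
      Matrix.tail_cons] at h
    exact h
  have hik : ∀ i k : Fin N, ∫ ω, wick4K Cv ω x *
      (⟪fld ω y₁, e i⟫_ℝ * ⟪fld ω y₂, C.q (e i)⟫_ℝ * ⟪fld ω y₃, e k⟫_ℝ * ⟪fld ω y₄, C.q (e k)⟫_ℝ) ∂kernelMeasure d N Cv =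
      8 * (Cv (x - y₁) * Cv (x - y₂) * Cv (x - y₃) * Cv (x - y₄)) *
        (⟪e i, C.q (e i)⟫_ℝ * ⟪e k, C.q (e k)⟫_ℝ + ⟪e i, e k⟫_ℝ * ⟪C.q (e i), C.q (e k)⟫_ℝ
          + ⟪e i, C.q (e k)⟫_ℝ * ⟪C.q (e i), e k⟫_ℝ) := by
    intro i k
    have h := integral_wick4K_mul_four hK x ![y₁, y₂, y₃, y₄] ![e i, C.q (e i), e k, C.q (e k)]
    simp only [Matrix.cons_val_zero, Matrix.cons_val_one, Matrix.cons_val_two, Matrix.cons_val_three, Matrix.head_cons,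
      Matrix.tail_cons] at h
    exact h
  have e1 : (fun ω => wick4K Cv ω x * (⟪fld ω y₁, C.q (fld ω y₂)⟫_ℝ * ⟪fld ω y₃, C.q (fld ω y₄)⟫_ℝ)) =
      fun ω => ∑ i : Fin N, ∑ k : Fin N, wick4K Cv ω x *
        (⟪fld ω y₁, e i⟫_ℝ * ⟪fld ω y₂, C.q (e i)⟫_ℝ * ⟪fld ω y₃, e k⟫_ℝ * ⟪fld ω y₄, C.q (e k)⟫_ℝ) := by
    funext ω
    rw [JJ_expand, Finset.mul_sum]
    exact Finset.sum_congr rfl fun i _ => Finset.mul_sum _ _ _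
  rw [e1, integral_finsetSum _ (fun i _ => integrable_finsetSum _ fun k _ => hI i k), Finset.mul_sum]
  refine Finset.sum_congr rfl fun i _ => ?_
  rw [integral_finsetSum _ (fun k _ => hI i k), Finset.mul_sum]
  exact Finset.sum_congr rfl fun k _ => hik i k

/-- **THE TWO-LOOP PICTURE OF (2.28) VANISHES, on `ηℤ^d`, for the Gaussian field of every positive semidefinite colour-diagonal
kernel** (free boundary conditions `C = C^η_{M²}`, periodic `C = C_L`, …): `∫ :|φ(x)|⁴:_C ⟪φ(y₁),qφ(y₂)⟫⟪φ(y₃),qφ(y₄)⟫ dμ_C = 0` for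
all positions — each loop carries a single `q`: the colour trace is `(tr q)² − tr q² + tr q² = 0` (`⟪e_i,qe_i⟫ = 0`,
`Σ⟪e_i,e_k⟫⟪qe_i,qe_k⟫ = −tr q²`, `Σ⟪e_i,qe_k⟫⟪qe_i,e_k⟫ = tr q²`), the p. 434 mechanism *"a loop of scalar field lines with an odd
number of vector field legs … tr q^{2n+1} = 0"*. [cite: Balaban1983Higgs3, (2.28) p.431] -/
theorem integral_wick4K_JJ_eq_zero (hK : IsPosSemidefKernel (scalarKernel d N Cv)) (x y₁ y₂ y₃ y₄ : ZSite d) :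
    ∫ ω, wick4K Cv ω x * (⟪fld ω y₁, C.q (fld ω y₂)⟫_ℝ * ⟪fld ω y₃, C.q (fld ω y₄)⟫_ℝ) ∂kernelMeasure d N Cv = 0 := by
  rw [integral_wick4K_JJ_eq C hK]
  simp only [inner_q_self, mul_zero, zero_add, Finset.sum_add_distrib]
  rw [sum_inner_mul_inner_qq C, sum_inner_mul_inner_q_q C]
  ring

end Pictures

/-! ## §2 (2.28) on `ηℤ^d` for the Gaussian field `dμ_C` of every positive semidefinite colour-diagonal kernel — free boundary
conditions (`C = C^η_{M²}`, `B3WTFreeMeasure.freeMeasure`) and periodic boundary conditions (`C = C_L`, the torus fields read on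
`ℤ^d`, `B3WTPeriodicMeasure.periodicMeasure`) alike -/

section Eq228

/-- **`∫ :|φ(x)|⁴: ⟨∂^ηφ,Bqφ⟩⟨∂^ηφ,∂^ηλqφ⟩ dμ_C = Σ_{b,b′}(η^dB_bη⁻¹)(η^d(∂^ηλ)(b′)η⁻¹)·∫ :|φ(x)|⁴: J(b₋,b₊)J(b′₋,b′₊) dμ_C`** — the
product of the two current pairings against the Wick-ordered quartic vertex is the sum over the positions `b, b′` of the two
current vertices of the two-loop pictures of (2.28). [cite: Balaban1983Higgs3, (2.28) p.431] -/
theorem integral_wick4K_curJ_pairD_expand (hK : IsPosSemidefKernel (scalarKernel d N Cv)) (x : ZSite d) (S : Finset (ZSite d))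
    (B : ZSite d → Fin d → ℝ) (lam : ZSite d → ℝ) :
    ∫ ω, wick4K Cv ω x * (curJ C η S B ω * pairD C η S lam ω) ∂kernelMeasure d N Cv =
      ∑ y ∈ S, ∑ μ : Fin d, ∑ y' ∈ S, ∑ ν : Fin d,
        (η ^ d * B y μ * η⁻¹) * (η ^ d * pdiffZ η⁻¹ ν lam y' * η⁻¹) *
          ∫ ω, wick4K Cv ω x * (⟪fld ω y, C.q (fld ω (y + unitVec μ))⟫_ℝ * ⟪fld ω y', C.q (fld ω (y' + unitVec ν))⟫_ℝ)
            ∂kernelMeasure d N Cv := by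
  have e1 : (fun ω => wick4K Cv ω x * (curJ C η S B ω * pairD C η S lam ω)) = fun ω =>
      ∑ y ∈ S, ∑ μ : Fin d, ∑ y' ∈ S, ∑ ν : Fin d, (η ^ d * B y μ * η⁻¹) * (η ^ d * pdiffZ η⁻¹ ν lam y' * η⁻¹) *
        (wick4K Cv ω x * (⟪fld ω y, C.q (fld ω (y + unitVec μ))⟫_ℝ * ⟪fld ω y', C.q (fld ω (y' + unitVec ν))⟫_ℝ)) := by
    funext ω
    rw [curJ_mul_pairD_expand, Finset.mul_sum]
    refine Finset.sum_congr rfl fun y _ => ?_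
    rw [Finset.mul_sum]
    refine Finset.sum_congr rfl fun μ _ => ?_
    rw [Finset.mul_sum]
    refine Finset.sum_congr rfl fun y' _ => ?_
    rw [Finset.mul_sum]
    exact Finset.sum_congr rfl fun ν _ => by ring
  have hi : ∀ (y : ZSite d) (μ : Fin d) (y' : ZSite d) (ν : Fin d), Integrable (fun ω =>
      (η ^ d * B y μ * η⁻¹) * (η ^ d * pdiffZ η⁻¹ ν lam y' * η⁻¹) *
        (wick4K Cv ω x * (⟪fld ω y, C.q (fld ω (y + unitVec μ))⟫_ℝ * ⟪fld ω y', C.q (fld ω (y' + unitVec ν))⟫_ℝ)))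
      (kernelMeasure d N Cv) := fun y μ y' ν => (integrable_wick4K_mul_JJ C hK x _ _ _ _).const_mul _
  rw [e1, integral_finsetSum _ (fun y _ => integrable_finsetSum _ fun μ _ => integrable_finsetSum _ fun y' _ =>
    integrable_finsetSum _ fun ν _ => hi y μ y' ν)]
  refine Finset.sum_congr rfl fun y _ => ?_
  rw [integral_finsetSum _ (fun μ _ => integrable_finsetSum _ fun y' _ => integrable_finsetSum _ fun ν _ => hi y μ y' ν)]
  refine Finset.sum_congr rfl fun μ _ => ?_
  rw [integral_finsetSum _ (fun y' _ => integrable_finsetSum _ fun ν _ => hi y μ y' ν)]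
  refine Finset.sum_congr rfl fun y' _ => ?_
  rw [integral_finsetSum _ (fun ν _ => hi y μ y' ν)]
  exact Finset.sum_congr rfl fun ν _ => integral_const_mul _ _

/-- … and therefore **vanishes**: `∫ :|φ(x)|⁴: ⟨∂^ηφ,Bqφ⟩⟨∂^ηφ,∂^ηλqφ⟩ dμ_C = 0`. [cite: Balaban1983Higgs3, (2.28) p.431] -/
theorem integral_wick4K_curJ_pairD (hK : IsPosSemidefKernel (scalarKernel d N Cv)) (x : ZSite d) (S : Finset (ZSite d))
    (B : ZSite d → Fin d → ℝ) (lam : ZSite d → ℝ) :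
    ∫ ω, wick4K Cv ω x * (curJ C η S B ω * pairD C η S lam ω) ∂kernelMeasure d N Cv = 0 := by
  rw [integral_wick4K_curJ_pairD_expand C η hK]
  exact Finset.sum_eq_zero fun y _ => Finset.sum_eq_zero fun μ _ => Finset.sum_eq_zero fun y' _ =>
    Finset.sum_eq_zero fun ν _ => by rw [integral_wick4K_JJ_eq_zero C hK, mul_zero]

/-- integrability of `:|φ(x)|⁴: ⟨∂^ηφ,Bqφ⟩⟨∂^ηφ,∂^ηλqφ⟩`. [cite: Balaban1983Higgs3, (2.28) p.431] -/
theorem integrable_wick4K_curJ_pairD (hK : IsPosSemidefKernel (scalarKernel d N Cv)) (x : ZSite d) (S : Finset (ZSite d))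
    (B : ZSite d → Fin d → ℝ) (lam : ZSite d → ℝ) :
    Integrable (fun ω => wick4K Cv ω x * (curJ C η S B ω * pairD C η S lam ω)) (kernelMeasure d N Cv) := by
  have e1 : (fun ω => wick4K Cv ω x * (curJ C η S B ω * pairD C η S lam ω)) = fun ω =>
      ∑ y ∈ S, ∑ μ : Fin d, ∑ y' ∈ S, ∑ ν : Fin d, (η ^ d * B y μ * η⁻¹) * (η ^ d * pdiffZ η⁻¹ ν lam y' * η⁻¹) *
        (wick4K Cv ω x * (⟪fld ω y, C.q (fld ω (y + unitVec μ))⟫_ℝ * ⟪fld ω y', C.q (fld ω (y' + unitVec ν))⟫_ℝ)) := by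
    funext ω
    rw [curJ_mul_pairD_expand, Finset.mul_sum]
    refine Finset.sum_congr rfl fun y _ => ?_
    rw [Finset.mul_sum]
    refine Finset.sum_congr rfl fun μ _ => ?_
    rw [Finset.mul_sum]
    refine Finset.sum_congr rfl fun y' _ => ?_
    rw [Finset.mul_sum]
    exact Finset.sum_congr rfl fun ν _ => by ring
  rw [e1]
  exact integrable_finsetSum _ fun y _ => integrable_finsetSum _ fun μ _ => integrable_finsetSum _ fun y' _ =>
    integrable_finsetSum _ fun ν _ => (integrable_wick4K_mul_JJ C hK x _ _ _ _).const_mul _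

/-- **no seagull picture**: `∫ :|φ(x)|⁴: ⟨φ,B·∂^ηλq²φ⟩ dμ_C = 0`. [cite: Balaban1983Higgs3, (2.28) p.431] -/
theorem integral_wick4K_locQ (hK : IsPosSemidefKernel (scalarKernel d N Cv)) (x : ZSite d) (S : Finset (ZSite d))
    (B : ZSite d → Fin d → ℝ) (lam : ZSite d → ℝ) :
    ∫ ω, wick4K Cv ω x * locQ C η S B lam ω ∂kernelMeasure d N Cv = 0 := by
  have e1 : (fun ω => wick4K Cv ω x * locQ C η S B lam ω) = fun ω => ∑ y ∈ S, ∑ μ : Fin d,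
      (η ^ d * (B y μ * pdiffZ η⁻¹ μ lam y)) * (wick4K Cv ω x * ⟪fld ω y, (C.q.comp C.q) (fld ω y)⟫_ℝ) := by
    funext ω
    unfold locQ
    rw [Finset.mul_sum]
    refine Finset.sum_congr rfl fun y _ => ?_
    rw [Finset.mul_sum]
    exact Finset.sum_congr rfl fun μ _ => by rw [ContinuousLinearMap.comp_apply]; ring
  have hi : ∀ (y : ZSite d) (μ : Fin d), Integrable (fun ω =>
      (η ^ d * (B y μ * pdiffZ η⁻¹ μ lam y)) * (wick4K Cv ω x * ⟪fld ω y, (C.q.comp C.q) (fld ω y)⟫_ℝ)) (kernelMeasure d N Cv) :=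
    fun y μ => (integrable_wick4K_mul_biq hK x y y _).const_mul _
  rw [e1, integral_finsetSum _ (fun y _ => integrable_finsetSum _ fun μ _ => hi y μ)]
  exact Finset.sum_eq_zero fun y _ => by
    rw [integral_finsetSum _ (fun μ _ => hi y μ)]
    exact Finset.sum_eq_zero fun μ _ => by rw [integral_const_mul, integral_wick4K_biq_eq_zero hK, mul_zero]

/-- integrability of `:|φ(x)|⁴: ⟨φ,B·∂^ηλq²φ⟩`. [cite: Balaban1983Higgs3, (2.28) p.431] -/
theorem integrable_wick4K_locQ (hK : IsPosSemidefKernel (scalarKernel d N Cv)) (x : ZSite d) (S : Finset (ZSite d))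
    (B : ZSite d → Fin d → ℝ) (lam : ZSite d → ℝ) :
    Integrable (fun ω => wick4K Cv ω x * locQ C η S B lam ω) (kernelMeasure d N Cv) := by
  have e1 : (fun ω => wick4K Cv ω x * locQ C η S B lam ω) = fun ω => ∑ y ∈ S, ∑ μ : Fin d,
      (η ^ d * (B y μ * pdiffZ η⁻¹ μ lam y)) * (wick4K Cv ω x * ⟪fld ω y, (C.q.comp C.q) (fld ω y)⟫_ℝ) := by
    funext ω
    unfold locQ
    rw [Finset.mul_sum]
    refine Finset.sum_congr rfl fun y _ => ?_
    rw [Finset.mul_sum]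
    exact Finset.sum_congr rfl fun μ _ => by rw [ContinuousLinearMap.comp_apply]; ring
  rw [e1]
  exact integrable_finsetSum _ fun y _ => integrable_finsetSum _ fun μ _ => (integrable_wick4K_mul_biq hK x y y _).const_mul _

/-- **no seagull picture**: `∫ :|φ(x)|⁴: ⟨∂^ηφ,B∂^ηλq²φ⟩ dμ_C = 0`. [cite: Balaban1983Higgs3, (2.28) p.431] -/
theorem integral_wick4K_derQ (hK : IsPosSemidefKernel (scalarKernel d N Cv)) (x : ZSite d) (S : Finset (ZSite d))
    (B : ZSite d → Fin d → ℝ) (lam : ZSite d → ℝ) :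
    ∫ ω, wick4K Cv ω x * derQ C η S B lam ω ∂kernelMeasure d N Cv = 0 := by
  have e1 : (fun ω => wick4K Cv ω x * derQ C η S B lam ω) = fun ω => ∑ y ∈ S, ∑ μ : Fin d,
      ((η ^ d * (B y μ * pdiffZ η⁻¹ μ lam y) * η⁻¹) * (wick4K Cv ω x * ⟪fld ω (y + unitVec μ), (C.q.comp C.q) (fld ω y)⟫_ℝ)
        - (η ^ d * (B y μ * pdiffZ η⁻¹ μ lam y) * η⁻¹) * (wick4K Cv ω x * ⟪fld ω y, (C.q.comp C.q) (fld ω y)⟫_ℝ)) := by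
    funext ω
    rw [derQ_expand, Finset.mul_sum]
    refine Finset.sum_congr rfl fun y _ => ?_
    rw [Finset.mul_sum]
    exact Finset.sum_congr rfl fun μ _ => by simp only [ContinuousLinearMap.comp_apply]; ring
  have hi1 : ∀ (y : ZSite d) (μ : Fin d), Integrable (fun ω => (η ^ d * (B y μ * pdiffZ η⁻¹ μ lam y) * η⁻¹) *
      (wick4K Cv ω x * ⟪fld ω (y + unitVec μ), (C.q.comp C.q) (fld ω y)⟫_ℝ)) (kernelMeasure d N Cv) :=
    fun y μ => (integrable_wick4K_mul_biq hK x _ _ _).const_mul _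
  have hi2 : ∀ (y : ZSite d) (μ : Fin d), Integrable (fun ω => (η ^ d * (B y μ * pdiffZ η⁻¹ μ lam y) * η⁻¹) *
      (wick4K Cv ω x * ⟪fld ω y, (C.q.comp C.q) (fld ω y)⟫_ℝ)) (kernelMeasure d N Cv) :=
    fun y μ => (integrable_wick4K_mul_biq hK x _ _ _).const_mul _
  have hi : ∀ (y : ZSite d) (μ : Fin d), Integrable (fun ω =>
      (η ^ d * (B y μ * pdiffZ η⁻¹ μ lam y) * η⁻¹) * (wick4K Cv ω x * ⟪fld ω (y + unitVec μ), (C.q.comp C.q) (fld ω y)⟫_ℝ)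
        - (η ^ d * (B y μ * pdiffZ η⁻¹ μ lam y) * η⁻¹) * (wick4K Cv ω x * ⟪fld ω y, (C.q.comp C.q) (fld ω y)⟫_ℝ))
      (kernelMeasure d N Cv) := fun y μ => (hi1 y μ).sub (hi2 y μ)
  rw [e1, integral_finsetSum _ (fun y _ => integrable_finsetSum _ fun μ _ => hi y μ)]
  exact Finset.sum_eq_zero fun y _ => by
    rw [integral_finsetSum _ (fun μ _ => hi y μ)]
    exact Finset.sum_eq_zero fun μ _ => by
      rw [integral_sub (hi1 y μ) (hi2 y μ), integral_const_mul, integral_const_mul, integral_wick4K_biq_eq_zero hK,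
        integral_wick4K_biq_eq_zero hK, mul_zero, sub_zero]

/-- integrability of `:|φ(x)|⁴: ⟨∂^ηφ,B∂^ηλq²φ⟩`. [cite: Balaban1983Higgs3, (2.28) p.431] -/
theorem integrable_wick4K_derQ (hK : IsPosSemidefKernel (scalarKernel d N Cv)) (x : ZSite d) (S : Finset (ZSite d))
    (B : ZSite d → Fin d → ℝ) (lam : ZSite d → ℝ) :
    Integrable (fun ω => wick4K Cv ω x * derQ C η S B lam ω) (kernelMeasure d N Cv) := by
  have e1 : (fun ω => wick4K Cv ω x * derQ C η S B lam ω) = fun ω => ∑ y ∈ S, ∑ μ : Fin d,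
      ((η ^ d * (B y μ * pdiffZ η⁻¹ μ lam y) * η⁻¹) * (wick4K Cv ω x * ⟪fld ω (y + unitVec μ), (C.q.comp C.q) (fld ω y)⟫_ℝ)
        - (η ^ d * (B y μ * pdiffZ η⁻¹ μ lam y) * η⁻¹) * (wick4K Cv ω x * ⟪fld ω y, (C.q.comp C.q) (fld ω y)⟫_ℝ)) := by
    funext ω
    rw [derQ_expand, Finset.mul_sum]
    refine Finset.sum_congr rfl fun y _ => ?_
    rw [Finset.mul_sum]
    exact Finset.sum_congr rfl fun μ _ => by simp only [ContinuousLinearMap.comp_apply]; ring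
  rw [e1]
  exact integrable_finsetSum _ fun y _ => integrable_finsetSum _ fun μ _ =>
    ((integrable_wick4K_mul_biq hK x _ _ _).const_mul _).sub ((integrable_wick4K_mul_biq hK x _ _ _).const_mul _)

/-- the (2.28) integrand for `F = Σ_{x∈Δ}η^dα(x):|φ(x)|⁴:` split vertex by vertex (`:⟨∂^ηφ,∂^ηλqφ⟩: = ⟨∂^ηφ,∂^ηλqφ⟩` under `dμ_C`
by (2.25), `B3WT226FreeGaussian.normOrd_pairDK`). [cite: Balaban1983Higgs3, (2.28) p.431] -/
theorem eq228_integrand_splitK (hK : IsPosSemidefKernel (scalarKernel d N Cv)) (Δ S : Finset (ZSite d))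
    (B : ZSite d → Fin d → ℝ) (lam : ZSite d → ℝ) (α : ZSite d → ℝ) (ω : Cfg d N) :
    (∑ x ∈ Δ, η ^ d * (α x * wick4K Cv ω x)) * integrand226 C η (kernelMeasure d N Cv) S B lam ω =
      ∑ x ∈ Δ, (-C.e * (η ^ d * α x) * (wick4K Cv ω x * (curJ C η S B ω * pairD C η S lam ω))
        - C.e * (η ^ d * α x) * (wick4K Cv ω x * locQ C η S B lam ω)
        - (η * C.e) * (η ^ d * α x) * (wick4K Cv ω x * derQ C η S B lam ω)) := by
  rw [integrand226, normOrd_pairDK C η hK, Finset.sum_mul]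
  exact Finset.sum_congr rfl fun x _ => by ring

/-- **(2.28) ON `ηℤ^d`, THE GAUSSIAN INTEGRAL EVALUATED GRAPH BY GRAPH** — for the Gaussian field `dμ_C` of every positive
semidefinite colour-diagonal kernel and `F(φ) = Σ_{x∈Δ}η^dα(x):|φ(x)|⁴:_C` (print: `α = −λ_k`),
`∫dμ_C F·[(−e⟨∂^ηφ,Bqφ⟩)(:⟨∂^ηφ,∂^ηλqφ⟩:) − e⟨φ,B·∂^ηλq²φ⟩ − ηe⟨∂^ηφ,B∂^ηλq²φ⟩]`
`= Σ_{x∈Δ}Σ_{b,b′} (−e)·η^dα(x)·(η^dB_bη⁻¹)(η^d(∂^ηλ)(b′)η⁻¹)·∫dμ_C :|φ(x)|⁴:⟪φ(b₋),qφ(b₊)⟫⟪φ(b′₋),qφ(b′₊)⟫` — the sum of the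
two-loop pictures `A`–loop–`:φ⁴:`–loop–`∂^ηλ`; the seagull vertices contribute no picture. [cite: Balaban1983Higgs3, (2.28) p.431] -/
theorem eq228_wickK (hK : IsPosSemidefKernel (scalarKernel d N Cv)) (Δ S : Finset (ZSite d)) (B : ZSite d → Fin d → ℝ)
    (lam : ZSite d → ℝ) (α : ZSite d → ℝ) :
    ∫ ω, (∑ x ∈ Δ, η ^ d * (α x * wick4K Cv ω x)) * integrand226 C η (kernelMeasure d N Cv) S B lam ω ∂kernelMeasure d N Cv =
      ∑ x ∈ Δ, ∑ y ∈ S, ∑ μ : Fin d, ∑ y' ∈ S, ∑ ν : Fin d,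
        (-C.e * (η ^ d * α x)) * ((η ^ d * B y μ * η⁻¹) * (η ^ d * pdiffZ η⁻¹ ν lam y' * η⁻¹)) *
          ∫ ω, wick4K Cv ω x * (⟪fld ω y, C.q (fld ω (y + unitVec μ))⟫_ℝ * ⟪fld ω y', C.q (fld ω (y' + unitVec ν))⟫_ℝ)
            ∂kernelMeasure d N Cv := by
  have i1 := fun x => integrable_wick4K_curJ_pairD C η hK x S B lam
  have i2 := fun x => integrable_wick4K_locQ C η hK x S B lam
  have i3 := fun x => integrable_wick4K_derQ C η hK x S B lam
  have hI : ∀ x : ZSite d, Integrable (fun ω =>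
      (-C.e * (η ^ d * α x) * (wick4K Cv ω x * (curJ C η S B ω * pairD C η S lam ω))
        - C.e * (η ^ d * α x) * (wick4K Cv ω x * locQ C η S B lam ω)
        - (η * C.e) * (η ^ d * α x) * (wick4K Cv ω x * derQ C η S B lam ω))) (kernelMeasure d N Cv) :=
    fun x => (((i1 x).const_mul _).sub ((i2 x).const_mul _)).sub ((i3 x).const_mul _)
  simp_rw [eq228_integrand_splitK C η hK]
  rw [integral_finsetSum _ (fun x _ => hI x)]
  refine Finset.sum_congr rfl fun x _ => ?_
  have j12 : Integrable (fun ω =>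
      (-C.e * (η ^ d * α x) * (wick4K Cv ω x * (curJ C η S B ω * pairD C η S lam ω))
        - C.e * (η ^ d * α x) * (wick4K Cv ω x * locQ C η S B lam ω))) (kernelMeasure d N Cv) :=
    ((i1 x).const_mul _).sub ((i2 x).const_mul _)
  rw [integral_sub j12 ((i3 x).const_mul _), integral_sub ((i1 x).const_mul _) ((i2 x).const_mul _),
    integral_const_mul, integral_const_mul, integral_const_mul, integral_wick4K_locQ C η hK, integral_wick4K_derQ C η hK,
    integral_wick4K_curJ_pairD_expand C η hK, mul_zero, mul_zero, sub_zero, sub_zero, Finset.mul_sum]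
  refine Finset.sum_congr rfl fun y _ => ?_
  rw [Finset.mul_sum]
  refine Finset.sum_congr rfl fun μ _ => ?_
  rw [Finset.mul_sum]
  refine Finset.sum_congr rfl fun y' _ => ?_
  rw [Finset.mul_sum]
  exact Finset.sum_congr rfl fun ν _ => by ring

/-- **(2.28) ON `ηℤ^d`, THE PICTURE `= 0`**: the sum of the two-loop pictures vanishes picture by picture
(`integral_wick4K_JJ_eq_zero`), for every positive semidefinite colour-diagonal kernel. [cite: Balaban1983Higgs3, (2.28) p.431] -/
theorem eq228_pictures_eq_zeroK (hK : IsPosSemidefKernel (scalarKernel d N Cv)) (Δ S : Finset (ZSite d))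
    (B : ZSite d → Fin d → ℝ) (lam : ZSite d → ℝ) (α : ZSite d → ℝ) :
    ∑ x ∈ Δ, ∑ y ∈ S, ∑ μ : Fin d, ∑ y' ∈ S, ∑ ν : Fin d,
        (-C.e * (η ^ d * α x)) * ((η ^ d * B y μ * η⁻¹) * (η ^ d * pdiffZ η⁻¹ ν lam y' * η⁻¹)) *
          ∫ ω, wick4K Cv ω x * (⟪fld ω y, C.q (fld ω (y + unitVec μ))⟫_ℝ * ⟪fld ω y', C.q (fld ω (y' + unitVec ν))⟫_ℝ)
            ∂kernelMeasure d N Cv = 0 :=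
  Finset.sum_eq_zero fun x _ => Finset.sum_eq_zero fun y _ => Finset.sum_eq_zero fun μ _ =>
    Finset.sum_eq_zero fun y' _ => Finset.sum_eq_zero fun ν _ => by rw [integral_wick4K_JJ_eq_zero C hK, mul_zero]

/-- **(2.28) FOR THE GAUSSIAN FIELD OF EVERY POSITIVE SEMIDEFINITE COLOUR-DIAGONAL KERNEL ON `ηℤ^d`, BOTH MEMBERS**: with
`F(φ) = Σ_{x∈Δ}η^dα(x):|φ(x)|⁴:_C`, the Gaussian left member
`∫dμ_C F·[(−e⟨∂^ηφ,Bqφ⟩)(:⟨∂^ηφ,∂^ηλqφ⟩:) − e⟨φ,B·∂^ηλq²φ⟩ − ηe⟨∂^ηφ,B∂^ηλq²φ⟩]` equals the sum of its two-loop pictures and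
vanishes — every `d`, `N`, `η`, every window `S` carrying the external legs `B`, `∂^ηλ`, every `Δ`, `α`.
[cite: Balaban1983Higgs3, (2.28) p.431] -/
theorem eq228_kernel (hK : IsPosSemidefKernel (scalarKernel d N Cv)) (Δ S : Finset (ZSite d)) (B : ZSite d → Fin d → ℝ)
    (lam : ZSite d → ℝ) (α : ZSite d → ℝ) :
    ∫ ω, (∑ x ∈ Δ, η ^ d * (α x * wick4K Cv ω x)) * integrand226 C η (kernelMeasure d N Cv) S B lam ω
      ∂kernelMeasure d N Cv = 0 := by
  rw [eq228_wickK C η hK, eq228_pictures_eq_zeroK C η hK]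

/-- **(2.28) AT FREE BOUNDARY CONDITIONS** (the instance `C = C^η_{M²}`, `η > 0`, `M² > 0`, of the infinite lattice `ηℤ^d`):
`∫dμ_{C^η_{M²}} (Σ_{x∈Δ}η^dα(x):|φ(x)|⁴:)·[(−e⟨∂^ηφ,Bqφ⟩)(:⟨∂^ηφ,∂^ηλqφ⟩:) − e⟨φ,B·∂^ηλq²φ⟩ − ηe⟨∂^ηφ,B∂^ηλq²φ⟩] = 0` — p. 431
*"They hold for free boundary conditions also"*, for the display (2.28). [cite: Balaban1983Higgs3, (2.28) p.431] -/
theorem eq228_free (hη : 0 < η) (hM : 0 < M2) (Δ S : Finset (ZSite d)) (B : ZSite d → Fin d → ℝ) (lam : ZSite d → ℝ)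
    (α : ZSite d → ℝ) :
    ∫ ω, (∑ x ∈ Δ, η ^ d * (α x * wick4K (CetaM d η M2) ω x)) * integrand226 C η (freeMeasure d N η M2) S B lam ω
      ∂freeMeasure d N η M2 = 0 :=
  eq228_kernel C η (Cv := CetaM d η M2) (isPosSemidefKernel_freeKernel hη hM) Δ S B lam α

/-- **(2.28) WITH PERIODIC BOUNDARY CONDITIONS, read on `ℤ^d`** (the instance `C = C_L`, the periodization of `C^η_{M²}`, i.e.
the torus Gaussian measure `dμ_{C_T}` read periodically, `B3WTPeriodicMeasure.map_pullT_torusMeasure`): the same identity under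
`dμ_{C_L}` for EVERY period `L ≥ 1` — so the print's *"limit of the identities with periodic boundary conditions"* is available
for (2.28) but not needed: the identity holds kernel by kernel. [cite: Balaban1983Higgs3, (2.28) p.431] -/
theorem eq228_periodic {L : ℕ} [NeZero L] (hη : 0 < η) (hM : 0 < M2) (hL : 1 ≤ L) (Δ S : Finset (ZSite d))
    (B : ZSite d → Fin d → ℝ) (lam : ZSite d → ℝ) (α : ZSite d → ℝ) :
    ∫ ω, (∑ x ∈ Δ, η ^ d * (α x * wick4K (perC L (CetaM d η M2)) ω x)) *
        integrand226 C η (periodicMeasure d N L η M2) S B lam ω ∂periodicMeasure d N L η M2 = 0 :=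
  eq228_kernel C η (Cv := perC L (CetaM d η M2)) (isPosSemidefKernel_periodic hη hM hL) Δ S B lam α

/-- **(2.28), both members, at free boundary conditions**: the Gaussian left member equals the sum of the two-loop pictures with
propagators `C^η_{M²}` on `ηℤ^d`, and that sum is `0` picture by picture. [cite: Balaban1983Higgs3, (2.28) p.431] -/
theorem eq228_free_both (hη : 0 < η) (hM : 0 < M2) (Δ S : Finset (ZSite d)) (B : ZSite d → Fin d → ℝ) (lam : ZSite d → ℝ)
    (α : ZSite d → ℝ) :
    (∫ ω, (∑ x ∈ Δ, η ^ d * (α x * wick4K (CetaM d η M2) ω x)) * integrand226 C η (freeMeasure d N η M2) S B lam ω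
        ∂freeMeasure d N η M2 =
      ∑ x ∈ Δ, ∑ y ∈ S, ∑ μ : Fin d, ∑ y' ∈ S, ∑ ν : Fin d,
        (-C.e * (η ^ d * α x)) * ((η ^ d * B y μ * η⁻¹) * (η ^ d * pdiffZ η⁻¹ ν lam y' * η⁻¹)) *
          ∫ ω, wick4K (CetaM d η M2) ω x *
            (⟪fld ω y, C.q (fld ω (y + unitVec μ))⟫_ℝ * ⟪fld ω y', C.q (fld ω (y' + unitVec ν))⟫_ℝ) ∂freeMeasure d N η M2) ∧
    (∑ x ∈ Δ, ∑ y ∈ S, ∑ μ : Fin d, ∑ y' ∈ S, ∑ ν : Fin d,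
        (-C.e * (η ^ d * α x)) * ((η ^ d * B y μ * η⁻¹) * (η ^ d * pdiffZ η⁻¹ ν lam y' * η⁻¹)) *
          ∫ ω, wick4K (CetaM d η M2) ω x *
            (⟪fld ω y, C.q (fld ω (y + unitVec μ))⟫_ℝ * ⟪fld ω y', C.q (fld ω (y' + unitVec ν))⟫_ℝ) ∂freeMeasure d N η M2 = 0) :=
  ⟨eq228_wickK C η (Cv := CetaM d η M2) (isPosSemidefKernel_freeKernel hη hM) Δ S B lam α,
    eq228_pictures_eq_zeroK C η (Cv := CetaM d η M2) (isPosSemidefKernel_freeKernel hη hM) Δ S B lam α⟩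

/-- **the un-ordered form**: for the local even polynomial `F(φ) = Σ_{x∈Δ}η^d(α(x)|φ(x)|⁴ + β(x)|φ(x)|² + γ(x))` whose coefficients
are those of `α:|φ(x)|⁴:_C` (`β = −2(N+2)C(0)α`, `γ = N(N+2)C(0)²α` — the Wick constants of the integration covariance, as in the
torus file `B3WT228Graphs.eq228_left_wickOrdered`), the Gaussian left member of (2.28) under `dμ_C` vanishes.
[cite: Balaban1983Higgs3, (2.28) p.431] -/
theorem eq228_kernel_poly (hK : IsPosSemidefKernel (scalarKernel d N Cv)) (Δ S : Finset (ZSite d)) (B : ZSite d → Fin d → ℝ)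
    (lam : ZSite d → ℝ) (α : ZSite d → ℝ) :
    ∫ ω, (∑ x ∈ Δ, η ^ d * (α x * ‖fld ω x‖ ^ 4 + (-(2 * (N + 2) * Cv 0 * α x)) * ‖fld ω x‖ ^ 2
        + N * (N + 2) * Cv 0 ^ 2 * α x)) * integrand226 C η (kernelMeasure d N Cv) S B lam ω ∂kernelMeasure d N Cv = 0 := by
  rw [← eq228_kernel C η hK Δ S B lam α]
  refine integral_congr_ae (ae_of_all _ fun ω => ?_)
  simp only [wick4K_def]
  congr 1
  exact Finset.sum_congr rfl fun x _ => by ring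

end Eq228

/-! ## §3 Supplements: measurability, the free-boundary display spelled out, and the periodic identities as TORUS Gaussian integrals
(the identities "with periodic boundary conditions" of p. 431) -/

section Supplements

/-- the (2.28) integrand `F(φ)·[(−e⟨∂^ηφ,Bqφ⟩):⟨∂^ηφ,∂^ηλqφ⟩: − e⟨φ,B·∂^ηλq²φ⟩ − ηe⟨∂^ηφ,B∂^ηλq²φ⟩]` is measurable.
[cite: Balaban1983Higgs3, (2.28) p.431] -/
@[fun_prop]
theorem measurable_eq228_integrand (μ : Measure (Cfg d N)) (Δ S : Finset (ZSite d)) (B : ZSite d → Fin d → ℝ)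
    (lam : ZSite d → ℝ) (α : ZSite d → ℝ) :
    Measurable fun ω : Cfg d N => (∑ x ∈ Δ, η ^ d * (α x * wick4K Cv ω x)) * integrand226 C η μ S B lam ω :=
  (Finset.measurable_sum _ fun x _ => ((measurable_wick4K x).const_mul _).const_mul _).mul
    (measurable_integrand226 C η μ S B lam)

/-- **(2.28) at free boundary conditions, the display spelled out**:
`∫dμ_{C^η_{M²}}(φ) (Σ_{x∈Δ}η^dα(x):|φ(x)|⁴:)·[(−e⟨∂^ηφ,Bqφ⟩)(:⟨∂^ηφ,∂^ηλqφ⟩:) − e⟨φ,B·∂^ηλq²φ⟩ − ηe⟨∂^ηφ,B∂^ηλq²φ⟩] = 0` on `ηℤ^d`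
(`η > 0`, `M² > 0`; the normal ordering with respect to `dμ_{C^η_{M²}}`; print: `α = −λ_k`). [cite: Balaban1983Higgs3, (2.28) p.431] -/
theorem eq228_free_explicit (hη : 0 < η) (hM : 0 < M2) (Δ S : Finset (ZSite d)) (B : ZSite d → Fin d → ℝ)
    (lam : ZSite d → ℝ) (α : ZSite d → ℝ) :
    ∫ ω, (∑ x ∈ Δ, η ^ d * (α x * wick4K (CetaM d η M2) ω x)) *
        ((-C.e * curJ C η S B ω) * normOrd (freeMeasure d N η M2) (pairD C η S lam) ω - C.e * locQ C η S B lam ω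
          - (η * C.e) * derQ C η S B lam ω) ∂freeMeasure d N η M2 = 0 :=
  eq228_free C η hη hM Δ S B lam α

/-- **the identities "with periodic boundary conditions" ARE torus Gaussian integrals**: the (2.28) left member under the
`L`-periodic field `dμ_{C_L}` is the integral of the same integrand, read through `proj`, against the torus Gaussian measure
`dμ_{C_T}` of period `L` (`B3WTPeriodicMeasure.map_pullT_torusMeasure`). [cite: Balaban1983Higgs3, (2.28) p.431] -/
theorem eq228_periodic_eq_integral_torus {L : ℕ} [NeZero L] (hη : 0 < η) (hM : 0 < M2) (hL : 1 ≤ L) (Δ S : Finset (ZSite d))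
    (B : ZSite d → Fin d → ℝ) (lam : ZSite d → ℝ) (α : ZSite d → ℝ) :
    ∫ ω, (∑ x ∈ Δ, η ^ d * (α x * wick4K (perC L (CetaM d η M2)) ω x)) *
        integrand226 C η (periodicMeasure d N L η M2) S B lam ω ∂periodicMeasure d N L η M2 =
      ∫ ωT, (∑ x ∈ Δ, η ^ d * (α x * wick4K (perC L (CetaM d η M2)) (pullT L ωT) x)) *
        integrand226 C η (periodicMeasure d N L η M2) S B lam (pullT L ωT) ∂torusMeasure d N L η M2 := by
  rw [← map_pullT_torusMeasure hη hM hL, integral_map measurable_pullT.aemeasurable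
    (measurable_eq228_integrand C η _ Δ S B lam α).aestronglyMeasurable]

/-- **(2.28) WITH PERIODIC BOUNDARY CONDITIONS AS A TORUS IDENTITY**: for every period `L ≥ 1` the (2.28) integrand, read
periodically, integrates to `0` against the torus Gaussian measure `dμ_{C_T}` — the identities of p. 431 *"with periodic boundary
conditions"* (on the cubic torus `(ℤ/Lℤ)^d` of `B3WT226PeriodicKernel`) whose limit `L → ∞` the print invokes; for (2.28) each of
them, and the free one, holds outright. [cite: Balaban1983Higgs3, (2.28) p.431] -/
theorem eq228_torus {L : ℕ} [NeZero L] (hη : 0 < η) (hM : 0 < M2) (hL : 1 ≤ L) (Δ S : Finset (ZSite d))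
    (B : ZSite d → Fin d → ℝ) (lam : ZSite d → ℝ) (α : ZSite d → ℝ) :
    ∫ ωT, (∑ x ∈ Δ, η ^ d * (α x * wick4K (perC L (CetaM d η M2)) (pullT L ωT) x)) *
        integrand226 C η (periodicMeasure d N L η M2) S B lam (pullT L ωT) ∂torusMeasure d N L η M2 = 0 := by
  rw [← eq228_periodic_eq_integral_torus C η hη hM hL, eq228_periodic C η hη hM hL]

end Supplements
end Literature.MathematicalPhysics.QuantumFieldTheory.Balaban1983to89.B3WT228FreeGaussian

end
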